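/-
Origin: expansion seat `planner-pub-hodgecm-pv05-g3-0`, handover #6 v3 2026-08-18T06:09:31Z (`HOME/pub-hodgecm-pv05-g3/lean/Pv05g3/FockLattice.lean`, md5 97328d87, 539 lines);
landed by the gen-6 packager in gate run 24 as `HodgeCM/PerL34/FockLattice.lean` (import ^import Pv[0-9]+g[0-9]+\.→import HodgeCM.PerL34. ×1).
-/
/-
Origin: HOME/pub-hodgecm-pv05-g3/lean/Pv05g3/FockLattice.lean — session planner-pub-hodgecm-pv05-g3-0 (unit
pub-hodgecm-pv05-g3, DAG-node prover #05 gen 3).  Intended final place: `HodgeCM/PerL34/FockLattice.lean`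
(namespace `HodgeCM.PerL34.Fock`).  Imports this seat's `FockLieModule` (PACKAGER: rewrite `import Pv05g3.FockLieModule`
to `import HodgeCM.PerL34.FockLieModule`) and `Mathlib.RingTheory.Noetherian.Basic` / `Mathlib.LinearAlgebra.FiniteDimensional.Basic`; asserts nothing.
-/
import Mathlib.RingTheory.Noetherian.Basic
import Mathlib.LinearAlgebra.FiniteDimensional.Basic
import Summits.HodgeConjecture.HodgeCM.PerL34.FockLieModule

set_option autoImplicit false

/-!
# The `𝔤𝔩₃(ℂ)`-submodules of `ℂ[z₁, z₂, w]` are exactly the partial sums `⊕_{k ∈ S} F_k`, `S ⊆ ℤ` (and of `ℂ[z₁, z₂, z₃]`: the `⊕_{d ∈ S} Sym^d`)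

Complete reducibility and multiplicity one, as a CLASSIFICATION of invariant subspaces (KERNEL, hypothesis-free):

* `monomial_mem_of_oscRep_stable` : an `oscRep`-stable subspace contains the monomials of its members (the three
  Euler operators lie in the image of `𝔤𝔩₃`); `hpiece_ne_bot` : every `F_k ≠ 0`;
* **`eq_iSup_of_oscRep_stable : M = ⨆ k ∈ wtSet M, F_k`** for every `oscRep`-stable `M`, where
  `wtSet M = {k | M ∩ F_k ≠ 0}`; `iSup_hpiece_stable` : conversely every `⨆ k ∈ S, F_k` is stable;
* **`oscRep_stable_iff : (M is 𝔤𝔩₃-stable) ↔ ∃ S ⊆ ℤ, M = ⨆ k ∈ S, F_k`**, with `S` unique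
  (`wtSet_iSup_hpiece`, `iSup_hpiece_injective` — from `FockLieModule.hpiece_iSupIndep`);
* `hmon_toNat_mem_hpiece`, **`hpiece_not_finite : ¬ Module.Finite ℂ F_k`** — every `F_k` is
  infinite-dimensional (an infinite linearly independent family of monomials `z₁^{n+k⁺} w^{n+k⁻}`; Noetherian
  argument), so `θ_k` is never a finite-dimensional representation;
* `lieSubmodule_eq_iSup` : the same for Mathlib `LieSubmodule`s;
* **admissibility**: `kpiece k e := hpiece k ⊓ wpiece hwWt e` (the `w`-degree-`e` layer of `F_k`, on which
  `H = w∂_w` acts by `e`), `mem_kpiece_iff_support`, `kpiece_le_span` (spanned by the `k+e+1` monomials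
  `z₁^a z₂^{k+e-a} w^e`), **`kpiece_finite : Module.Finite ℂ F_k^{(e)}`**, `kpiece_eq_bot` (`k + e < 0`),
  `hmon_mem_kpiece`; `kpiece_iSupIndep`, **`hpiece_eq_iSup_kpiece : F_k = ⨆ e, F_k^{(e)}`** (so `F_k` is the
  internal direct sum of its finite-dimensional `K'`-layers: an admissible, `K'`-finite module);
* **`K'`-types, multiplicity one**: `coeff_hE01`, `support_inl_one_eq_zero_of_hE01`, **`kpiece_highest_iff`**:
  for `f ∈ F_k^{(e)}`, `E₊ f = 0 ↔ f ∈ ℂ · z₁^{k+e} w^e` (`E₊ = z₁∂₂ = hE 0 1` the `𝔲(2)`-raising operator) — each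
  non-zero layer (`kpiece_ne_bot_iff : F_k^{(e)} ≠ 0 ↔ 0 ≤ k + e`, `hmon_highest_mem_kpiece`) is the irreducible
  `U(2)`-module of highest weight `(k+e, 0)`, occurring once;
* generic polarisation kernels `coeff_X_mul_pderiv_of_ne`, `support_apply_eq_zero_of_X_mul_pderiv` (a polynomial
  killed by `X_a∂_b`, `a ≠ b`, has no `X_b`), and the definite pair: **`dpiece_highest_iff`** (in `Sym^d ℂ³` the vectors
  killed by `E₁₂ = z₁∂₂` and `E₂₃ = z₂∂₃` form the line `ℂ · z₁^d`: unique highest line, highest weight `(d,0,0)`),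
  `monomial_single_mem_dpiece`, `dpiece_finite` (each `Sym^d` finite-dimensional) of the scoped `𝔤𝔩₃`-module structure of
  `FockLieModule` — the lattice of `𝔤𝔩₃(ℂ)`-submodules of the Fock model is the power set of `ℤ`.

The definite pair `(U(1), U(3))` symmetrically: `degSet`, `monomial_mem_of_dERep_stable`, `dpiece_ne_bot`,
**`eq_iSup_of_dERep_stable`**, `iSup_dpiece_stable`, **`dERep_stable_iff : (M is 𝔤𝔩₃-stable) ↔ ∃ S ⊆ ℕ,
M = ⨆ d ∈ S, Sym^d`** (`degSet_iSup_dpiece`, `iSup_dpiece_injective`: `S` unique), `lieSubmodule_eq_iSup_def`.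

In particular the `U(1) × 𝔤𝔩₃(ℂ)`-module `ℂ[z₁,z₂,w]` is multiplicity-free and every `𝔤𝔩₃`-submodule is
automatically `U(1)`-stable: the two actions generate each other's commutant at the level of invariant subspaces
(the double-commutant flavour of Howe duality, for this pair, on the polynomial Fock space).

PACKAGER: rewrite `import Pv05g3.FockLieModule` ↦ `import HodgeCM.PerL34.FockLieModule`; same file-local
`attribute [local instance 100] LieRing.ofAssociativeRing`.
-/

namespace HodgeCM

namespace PerL34

namespace Fock

open MvPolynomial Finsupp

open scoped BigOperators

attribute [local instance 100] LieRing.ofAssociativeRing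

section Lattice

/-- the set of `U(1)`-weights `k` met by a subspace: `M ∩ F_k ≠ 0` -/
def wtSet (M : Submodule ℂ HarmModel) : Set ℤ := {k | M ⊓ hpiece k ≠ ⊥}

/-- an `oscRep`-stable subspace contains every monomial of each of its members (it is stable under the three Euler
operators `z_a ∂_{z_a}`, `w ∂_w`, which lie in the image of `𝔤𝔩₃`) -/
theorem monomial_mem_of_oscRep_stable (M : Submodule ℂ HarmModel)
    (hM : ∀ A : Matrix HarmVar HarmVar ℂ, ∀ f ∈ M, oscRep A f ∈ M) {f : HarmModel} (hf : f ∈ M)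
    {m : HarmVar →₀ ℕ} (hm : m ∈ f.support) : monomial m (1 : ℂ) ∈ M :=
  monomial_mem_of_eulerStable M ((isGStable_iff_oscRep M).mpr hM).1.euler hf hm

/-- every `F_k` is non-zero -/
theorem hpiece_ne_bot (k : ℤ) : hpiece k ≠ ⊥ := by
  rw [Submodule.ne_bot_iff]
  rcases Int.eq_nat_or_neg k with ⟨n, h | h⟩
  · exact ⟨hmon 0 n 0, by rw [h]; simpa using hmon_mem_hpiece 0 n 0, hmon_ne_zero 0 n 0⟩
  · exact ⟨hmon 0 0 n, by rw [h]; simpa using hmon_mem_hpiece 0 0 n, hmon_ne_zero 0 0 n⟩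

/-- **An `oscRep`-stable subspace is the sum of the `F_k` it meets.** -/
theorem eq_iSup_of_oscRep_stable (M : Submodule ℂ HarmModel)
    (hM : ∀ A : Matrix HarmVar HarmVar ℂ, ∀ f ∈ M, oscRep A f ∈ M) : M = ⨆ k ∈ wtSet M, hpiece k := by
  apply le_antisymm
  · intro f hf
    rw [f.as_sum]
    refine Submodule.sum_mem _ fun m hm => ?_
    have h1 : monomial m (1 : ℂ) ∈ M := monomial_mem_of_oscRep_stable M hM hf hm
    have hk : monomial m (1 : ℂ) ∈ hpiece (wt uWt m) := monomial_mem_wpiece rfl 1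
    have hS : wt uWt m ∈ wtSet M := by
      intro h
      have h2 : monomial m (1 : ℂ) ∈ M ⊓ hpiece (wt uWt m) := ⟨h1, hk⟩
      rw [h, Submodule.mem_bot, monomial_eq_zero] at h2
      exact one_ne_zero h2
    have h3 : monomial m (coeff m f) = coeff m f • monomial m (1 : ℂ) := by
      rw [smul_monomial, smul_eq_mul, mul_one]
    rw [h3]
    exact Submodule.smul_mem _ _
      (Submodule.mem_iSup_of_mem (wt uWt m) (Submodule.mem_iSup_of_mem hS hk))
  · refine iSup₂_le fun k hk => ?_
    obtain ⟨v, hv, hv0⟩ := (Submodule.ne_bot_iff _).mp hk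
    exact hpiece_le_of_oscRep_stable k M hM hv.1 hv0 hv.2

/-- conversely every partial sum `⊕_{k ∈ S} F_k` is `oscRep`-stable -/
theorem iSup_hpiece_stable (S : Set ℤ) :
    ∀ A : Matrix HarmVar HarmVar ℂ, ∀ f ∈ ⨆ k ∈ S, hpiece k, oscRep A f ∈ ⨆ k ∈ S, hpiece k := by
  intro A f hf
  have h : (⨆ k ∈ S, hpiece k) ≤ (⨆ k ∈ S, hpiece k).comap (oscRep A : HarmModel →ₗ[ℂ] HarmModel) := by
    refine iSup₂_le fun k hk => fun g hg => ?_
    exact Submodule.mem_comap.mpr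
      (Submodule.mem_iSup_of_mem k (Submodule.mem_iSup_of_mem hk (oscRep_mem_hpiece k A g hg)))
  exact h hf

/-- **Classification of the `𝔤𝔩₃(ℂ)`-stable subspaces of the Fock model**: they are exactly the `⊕_{k ∈ S} F_k`. -/
theorem oscRep_stable_iff (M : Submodule ℂ HarmModel) :
    (∀ A : Matrix HarmVar HarmVar ℂ, ∀ f ∈ M, oscRep A f ∈ M) ↔ ∃ S : Set ℤ, M = ⨆ k ∈ S, hpiece k := by
  constructor
  · exact fun hM => ⟨wtSet M, eq_iSup_of_oscRep_stable M hM⟩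
  · rintro ⟨S, rfl⟩
    exact iSup_hpiece_stable S

/-- … and `S` is unique: `S ↦ ⊕_{k ∈ S} F_k` is injective (the `F_k` are independent and non-zero). -/
theorem wtSet_iSup_hpiece (S : Set ℤ) : wtSet (⨆ k ∈ S, hpiece k) = S := by
  ext k
  constructor
  · intro hk
    by_contra hkS
    apply hk
    rw [inf_comm]
    exact (hpiece_iSupIndep.disjoint_biSup hkS).eq_bot
  · intro hkS h
    apply hpiece_ne_bot k
    rw [eq_bot_iff, ← h]
    exact le_inf (le_iSup₂_of_le k hkS le_rfl) le_rfl

/-- (Ported verbatim from the HodgeCMPerL package; no docstring in the source.) -/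
theorem iSup_hpiece_injective {S T : Set ℤ} (h : (⨆ k ∈ S, hpiece k) = ⨆ k ∈ T, hpiece k) : S = T := by
  rw [← wtSet_iSup_hpiece S, h, wtSet_iSup_hpiece]

/-- **Lie-submodule form**: the Lie submodules of `ℂ[z₁,z₂,w]` over `𝔤𝔩₃(ℂ)` (scoped instance of `FockLieModule`)
are exactly the partial sums of the `fockPiece k = F_k`; the lattice of submodules is the power set of `ℤ`. -/
theorem lieSubmodule_eq_iSup (N : LieSubmodule ℂ (Matrix HarmVar HarmVar ℂ) HarmModel) :
    ∃ S : Set ℤ, (N : Submodule ℂ HarmModel) = ⨆ k ∈ S, hpiece k :=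
  (oscRep_stable_iff _).mp fun _ _ hf => N.lie_mem hf

/-- the monomials `z₁^{n + k⁺} w^{n + k⁻}` (`n ∈ ℕ`): an infinite family inside `F_k` -/
theorem hmon_toNat_mem_hpiece (k : ℤ) (n : ℕ) : hmon (n + k.toNat) 0 (n + (-k).toNat) ∈ hpiece k := by
  have h := hmon_mem_hpiece (n + k.toNat) 0 (n + (-k).toNat)
  have hk : ((n + k.toNat : ℕ) : ℤ) + (0 : ℕ) - ((n + (-k).toNat : ℕ) : ℤ) = k := by
    push_cast
    have := Int.toNat_sub_toNat_neg k
    omega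
  rwa [hk] at h

/-- **Each `F_k` is infinite-dimensional** (`θ_k` is not a finite-dimensional representation). -/
theorem hpiece_not_finite (k : ℤ) : ¬ Module.Finite ℂ ↥(hpiece k) := by
  intro hfin
  let idx : ℕ → (HarmVar →₀ ℕ) := fun n => hexp (n + k.toNat) 0 (n + (-k).toNat)
  have hidx : Function.Injective idx := by
    intro n n' h
    have h0 := congrArg (fun m : HarmVar →₀ ℕ => m (Sum.inl 0)) h
    simp only [idx, hexp_inl_zero] at h0
    omega
  let v : ℕ → ↥(hpiece k) := fun n => ⟨hmon (n + k.toNat) 0 (n + (-k).toNat), hmon_toNat_mem_hpiece k n⟩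
  have hv : LinearIndependent ℂ v := by
    apply LinearIndependent.of_comp (hpiece k).subtype
    have h1 : ((hpiece k).subtype ∘ v) = (basisMonomials HarmVar ℂ) ∘ idx := by
      funext n
      simp only [Function.comp_apply, Submodule.subtype_apply, coe_basisMonomials, v, idx, hmon]
    rw [h1]
    exact (basisMonomials HarmVar ℂ).linearIndependent.comp idx hidx
  haveI : IsNoetherian ℂ ↥(hpiece k) := isNoetherian_of_isNoetherianRing_of_finite ℂ ↥(hpiece k)
  haveI : Finite ℕ := hv.finite_of_isNoetherian
  exact not_finite ℕ

end Lattice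

/-! ## The definite pair: the `𝔤𝔩₃(ℂ)`-submodules of `ℂ[z₁, z₂, z₃]` are the `⊕_{d ∈ S} Sym^d`, `S ⊆ ℕ` -/

section LatticeDef

/-- the set of degrees met by a subspace of `ℂ[z₁,z₂,z₃]` -/
def degSet (M : Submodule ℂ DefModel) : Set ℕ := {d | M ⊓ dpiece d ≠ ⊥}

/-- (Ported verbatim from the HodgeCMPerL package; no docstring in the source.) -/
theorem monomial_mem_of_dERep_stable (M : Submodule ℂ DefModel)
    (hM : ∀ A : Matrix (Fin 3) (Fin 3) ℂ, ∀ f ∈ M, dERep A f ∈ M) {f : DefModel} (hf : f ∈ M)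
    {m : Fin 3 →₀ ℕ} (hm : m ∈ f.support) : monomial m (1 : ℂ) ∈ M :=
  monomial_mem_of_eulerStable M (fun a g hg => by rw [← dE_apply, ← dERep_single]; exact hM _ g hg) hf hm

/-- (Ported verbatim from the HodgeCMPerL package; no docstring in the source.) -/
theorem dpiece_ne_bot (d : ℕ) : dpiece d ≠ ⊥ := by
  rw [Submodule.ne_bot_iff]
  exact ⟨monomial (single 0 d) 1, (mem_dpiece_iff_isHomogeneous d _).mpr
    (isHomogeneous_monomial _ (by rw [degree_single])), by rw [Ne, monomial_eq_zero]; exact one_ne_zero⟩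

/-- **A `dERep`-stable subspace of `ℂ[z₁,z₂,z₃]` is the sum of the `Sym^d` it meets.** -/
theorem eq_iSup_of_dERep_stable (M : Submodule ℂ DefModel)
    (hM : ∀ A : Matrix (Fin 3) (Fin 3) ℂ, ∀ f ∈ M, dERep A f ∈ M) : M = ⨆ d ∈ degSet M, dpiece d := by
  apply le_antisymm
  · intro f hf
    rw [f.as_sum]
    refine Submodule.sum_mem _ fun m hm => ?_
    have h1 : monomial m (1 : ℂ) ∈ M := monomial_mem_of_dERep_stable M hM hf hm
    have hk : monomial m (1 : ℂ) ∈ dpiece m.degree :=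
      (mem_dpiece_iff_isHomogeneous _ _).mpr (isHomogeneous_monomial _ rfl)
    have hS : m.degree ∈ degSet M := by
      intro h
      have h2 : monomial m (1 : ℂ) ∈ M ⊓ dpiece m.degree := ⟨h1, hk⟩
      rw [h, Submodule.mem_bot, monomial_eq_zero] at h2
      exact one_ne_zero h2
    have h3 : monomial m (coeff m f) = coeff m f • monomial m (1 : ℂ) := by
      rw [smul_monomial, smul_eq_mul, mul_one]
    rw [h3]
    exact Submodule.smul_mem _ _
      (Submodule.mem_iSup_of_mem m.degree (Submodule.mem_iSup_of_mem hS hk))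
  · refine iSup₂_le fun d hd => ?_
    obtain ⟨v, hv, hv0⟩ := (Submodule.ne_bot_iff _).mp hd
    exact dpiece_le_of_dERep_stable d M hM hv.1 hv0 hv.2

/-- (Ported verbatim from the HodgeCMPerL package; no docstring in the source.) -/
theorem iSup_dpiece_stable (S : Set ℕ) :
    ∀ A : Matrix (Fin 3) (Fin 3) ℂ, ∀ f ∈ ⨆ d ∈ S, dpiece d, dERep A f ∈ ⨆ d ∈ S, dpiece d := by
  intro A f hf
  have h : (⨆ d ∈ S, dpiece d) ≤ (⨆ d ∈ S, dpiece d).comap (dERep A : DefModel →ₗ[ℂ] DefModel) := by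
    refine iSup₂_le fun d hd => fun g hg => ?_
    exact Submodule.mem_comap.mpr
      (Submodule.mem_iSup_of_mem d (Submodule.mem_iSup_of_mem hd (dERep_mem_dpiece d A g hg)))
  exact h hf

/-- **Classification of the `𝔤𝔩₃(ℂ)`-stable subspaces of `ℂ[z₁,z₂,z₃]`**: exactly the `⊕_{d ∈ S} Sym^d`. -/
theorem dERep_stable_iff (M : Submodule ℂ DefModel) :
    (∀ A : Matrix (Fin 3) (Fin 3) ℂ, ∀ f ∈ M, dERep A f ∈ M) ↔ ∃ S : Set ℕ, M = ⨆ d ∈ S, dpiece d := by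
  constructor
  · exact fun hM => ⟨degSet M, eq_iSup_of_dERep_stable M hM⟩
  · rintro ⟨S, rfl⟩
    exact iSup_dpiece_stable S

/-- (Ported verbatim from the HodgeCMPerL package; no docstring in the source.) -/
theorem degSet_iSup_dpiece (S : Set ℕ) : degSet (⨆ d ∈ S, dpiece d) = S := by
  ext d
  constructor
  · intro hd
    by_contra hdS
    apply hd
    rw [inf_comm]
    exact (dpiece_isInternal.submodule_iSupIndep.disjoint_biSup hdS).eq_bot
  · intro hdS h
    apply dpiece_ne_bot d
    rw [eq_bot_iff, ← h]
    exact le_inf (le_iSup₂_of_le d hdS le_rfl) le_rfl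

/-- (Ported verbatim from the HodgeCMPerL package; no docstring in the source.) -/
theorem iSup_dpiece_injective {S T : Set ℕ} (h : (⨆ d ∈ S, dpiece d) = ⨆ d ∈ T, dpiece d) : S = T := by
  rw [← degSet_iSup_dpiece S, h, degSet_iSup_dpiece]

/-- (Ported verbatim from the HodgeCMPerL package; no docstring in the source.) -/
theorem lieSubmodule_eq_iSup_def (N : LieSubmodule ℂ (Matrix (Fin 3) (Fin 3) ℂ) DefModel) :
    ∃ S : Set ℕ, (N : Submodule ℂ DefModel) = ⨆ d ∈ S, dpiece d :=
  (dERep_stable_iff _).mp fun _ _ hf => N.lie_mem hf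

end LatticeDef

/-! ## The `K'`-layers of `F_k` are finite-dimensional (admissibility) -/

section KPieces

/-- the `(U(1)-weight k, w-degree e)` layer `F_k^{(e)} = F_k ⊓ {w-degree e}` of `F_k`: the `e`-th
`K'`-layer (`K' = U(2) × U(1)`: `H = w∂_w` acts on it by the scalar `e`). -/
noncomputable def kpiece (k : ℤ) (e : ℕ) : Submodule ℂ HarmModel := hpiece k ⊓ wpiece hwWt e

/-- (Ported verbatim from the HodgeCMPerL package; no docstring in the source.) -/
theorem wt_hwWt' (m : HarmVar →₀ ℕ) : wt hwWt m = (m (Sum.inr ()) : ℤ) := by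
  simp only [wt, hwWt, Fintype.sum_sum_type, Fin.sum_univ_two, Fintype.sum_unique]
  ring

/-- (Ported verbatim from the HodgeCMPerL package; no docstring in the source.) -/
theorem mem_kpiece_iff_support (k : ℤ) (e : ℕ) (f : HarmModel) :
    f ∈ kpiece k e ↔ ∀ m ∈ f.support, wt uWt m = k ∧ m (Sum.inr ()) = e := by
  rw [kpiece, Submodule.mem_inf, hpiece, mem_wpiece_iff_support, mem_wpiece_iff_support]
  constructor
  · rintro ⟨h1, h2⟩ m hm
    refine ⟨h1 m hm, ?_⟩
    have := h2 m hm
    rw [wt_hwWt'] at this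
    exact_mod_cast this
  · intro h
    refine ⟨fun m hm => (h m hm).1, fun m hm => ?_⟩
    rw [wt_hwWt', (h m hm).2]

/-- `F_k^{(e)}` lies in the span of the finitely many monomials `z₁^a z₂^{k+e-a} w^e`, `0 ≤ a ≤ k + e`. -/
theorem kpiece_le_span (k : ℤ) (e : ℕ) :
    kpiece k e ≤ Submodule.span ℂ
      ↑((Finset.range ((k + e).toNat + 1)).image fun a => hmon a ((k + e).toNat - a) e) := by
  intro f hf
  rw [mem_kpiece_iff_support] at hf
  rw [f.as_sum]
  refine Submodule.sum_mem _ fun m hm => ?_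
  obtain ⟨hk, he⟩ := hf m hm
  rw [wt_uWt'] at hk
  have hN : m (Sum.inl 1) = (k + e).toNat - m (Sum.inl 0) := by omega
  have hle : m (Sum.inl 0) ≤ (k + e).toNat := by omega
  have hm' : m = hexp (m (Sum.inl 0)) ((k + e).toNat - m (Sum.inl 0)) e :=
    eq_hexp_iff.mpr ⟨rfl, hN, he⟩
  have hmon' : monomial m (coeff m f) =
      coeff m f • hmon (m (Sum.inl 0)) ((k + e).toNat - m (Sum.inl 0)) e := by
    rw [hmon, smul_monomial, smul_eq_mul, mul_one, ← hm']
  rw [hmon']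
  refine Submodule.smul_mem _ _ (Submodule.subset_span ?_)
  rw [Finset.coe_image]
  exact ⟨m (Sum.inl 0), by simpa [Finset.mem_range] using Nat.lt_succ_of_le hle, rfl⟩

/-- **Admissibility: every `K'`-layer `F_k^{(e)}` of `F_k` is finite-dimensional** (while `F_k` itself
is infinite-dimensional, `hpiece_not_finite`). -/
theorem kpiece_finite (k : ℤ) (e : ℕ) : Module.Finite ℂ ↥(kpiece k e) :=
  Submodule.finiteDimensional_of_le (kpiece_le_span k e)

/-- the layers vanish below `e = -k`: `F_k^{(e)} = 0` when `k + e < 0` -/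
theorem kpiece_eq_bot (k : ℤ) (e : ℕ) (h : k + e < 0) : kpiece k e = ⊥ := by
  rw [eq_bot_iff]
  intro f hf
  rw [mem_kpiece_iff_support] at hf
  rw [Submodule.mem_bot]
  by_contra hne
  obtain ⟨m, hm⟩ := support_nonempty.mpr hne
  obtain ⟨hk, he⟩ := hf m hm
  rw [wt_uWt'] at hk
  omega

/-- (Ported verbatim from the HodgeCMPerL package; no docstring in the source.) -/
theorem hmon_mem_kpiece (a b e : ℕ) : hmon a b e ∈ kpiece ((a : ℤ) + b - e) e :=
  ⟨hmon_mem_hpiece a b e, monomial_mem_wpiece (by rw [wt_hwWt', hexp_inr]) 1⟩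

end KPieces

section KLayers

/-- the layers of `F_k` are independent -/
theorem kpiece_iSupIndep (k : ℤ) : iSupIndep fun e : ℕ => kpiece k e := by
  have h1 : iSupIndep fun e : ℤ => wpiece (σ := HarmVar) hwWt e := (wpiece_isInternal hwWt).submodule_iSupIndep
  have h2 : iSupIndep fun e : ℕ => wpiece (σ := HarmVar) hwWt (e : ℤ) :=
    h1.comp (f := fun e : ℕ => (e : ℤ)) fun a b h => Int.ofNat_inj.mp h
  exact h2.mono fun e => inf_le_right

/-- **`F_k` is the (internal) direct sum of its finite-dimensional `K'`-layers**: `F_k = ⨆_e F_k^{(e)}`. -/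
theorem hpiece_eq_iSup_kpiece (k : ℤ) : hpiece k = ⨆ e : ℕ, kpiece k e := by
  apply le_antisymm
  · intro f hf
    rw [f.as_sum]
    refine Submodule.sum_mem _ fun m hm => ?_
    have hk : wt uWt m = k := (mem_wpiece_iff_support uWt k f).mp hf m hm
    have hmem : monomial m (coeff m f) ∈ kpiece k (m (Sum.inr ())) :=
      ⟨monomial_mem_wpiece hk _, monomial_mem_wpiece (by rw [wt_hwWt']) _⟩
    exact Submodule.mem_iSup_of_mem (m (Sum.inr ())) hmem
  · exact iSup_le fun e => inf_le_left

end KLayers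

/-! ## `K'`-types with multiplicity one -/

section KTypes

/-- coefficient extraction for the `𝔲(2)`-raising operator `E₊ = z₁∂₂ = hE 0 1` at an exponent containing `z₁` -/
theorem coeff_hE01 (f : HarmModel) (n : HarmVar →₀ ℕ) (hn : n (Sum.inl 0) ≠ 0) :
    coeff n (hE 0 1 f) =
      ((n (Sum.inl 1) + 1 : ℕ) : ℂ) * coeff (n - single (Sum.inl 0) 1 + single (Sum.inl 1) 1) f := by
  rw [hE_apply, coeff_X_mul', if_pos (Finsupp.mem_support_iff.mpr hn), coeff_pderiv, Finsupp.tsub_apply,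
    single_apply, if_neg (by decide : ¬ (Sum.inl 0 : HarmVar) = Sum.inl 1), tsub_zero, mul_comm]
  push_cast
  ring


-- port_pkg: scope closed for this part
end KTypes
end Fock
end PerL34
end HodgeCM
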